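import Literature.Analysis.FluidPDE.NSBoundedSuitablePrelim
import Literature.Analysis.FluidPDE.NSSuitableESSProofs
import HarnessLib

/-!
# Bounded distributional Navier–Stokes solutions: the weak spatial gradient as a strong `L²`
# limit of mollified gradients (Caccioppoli–Cauchy estimate)

Analysis/FluidPDE support file (theorem-only) for the discharge of
`Literature.Analysis.FluidPDE.SereginSverak2009.SuitableOfBounded` (Seregin–Šverák 2009,
Remark 3.4; see `NSBoundedSuitablePrelim` for the context). Let `(u, p)` be a distributional
solution of the unforced Navier–Stokes system (viscosity `ν > 0`) on an open set `Ω ⊆ ℝ × E` of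
finite measure, with `u` essentially bounded on `Ω` and `p ∈ L^{3/2}(Ω)`. The space–time
mollifications `Vₙ = kₙ ⋆ 𝟙_Ω u`, `Nₙᵢ = kₙ ⋆ 𝟙_Ω (uᵢ u)`, `Pₙ = kₙ ⋆ 𝟙_Ω p` (accepted
`FluidPDE/SpaceTimeMollifier`) satisfy the mollified system pointwise on every compact `K ⊆ Ω`
for large `n`, and this system is **linear** in `(V, N, P)`. Writing the smooth local energy
identity (accepted `local_energy_identity_smooth`, CKN 1982, §2) for the mollification by the
*difference kernel* `kₘ - kₙ` against a cut-off `χ = 1` on `K` and absorbing the term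
`χ ⟪D V (Nᵢ), bᵢ⟫` by Young's inequality gives the Caccioppoli-type bound

`ν ∫∫ χ |D(Vₘ - Vₙ)|² ≤ ∫∫ |Vₘ - Vₙ|² (νΔχ + ∂ₜχ) + 2 Σᵢ ∫∫ ⟪Nₘᵢ - Nₙᵢ, ∇χ⟫ (Vₘ - Vₙ)ᵢ`
`  + 2 ∫∫ (Pₘ - Pₙ) ⟪Vₘ - Vₙ, ∇χ⟫ + ε⁻¹ Σᵢ ∫∫ χ |Nₘᵢ - Nₙᵢ|²`,

whose right-hand side tends to `0` as `m, n → ∞` because `Vₙ → 𝟙_Ω u` in `L²` and `L³`,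
`Nₙᵢ → 𝟙_Ω uᵢu` in `L²`, `Pₙ → 𝟙_Ω p` in `L^{3/2}` (accepted `FluidPDE/MollifiedLimits`,
`FunctionSpaces/MollificationLp`). Hence `𝟙_K D Vₙ` is a Cauchy sequence in `L²(ℝ × E)`, and the
completeness of `L²` provides the limit `G̃` — the (zero-extended) weak spatial gradient of `u` on
the interior of `K`, as shown in `NSBoundedSuitableEnergy`. This is the standard proof that
bounded (more generally `L⁴_loc`) distributional solutions have `∇u ∈ L²_loc` (Serrin 1962, §2;
the `W^{1,0}_2` half of "it is certainly true in `B × ]-1,-a²[`", Seregin–Šverák 2009, §2 p. 6).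

## Main statements (all proved)

* `integral_weight_inner_apply_le` — Young's inequality under the integral sign,
  `∫ w ⟪D(N), e⟫ ≤ (ε/2) ∫ w |D|² + (2ε)⁻¹ ∫ w |N|²`;
* `mollified_dissipation_le` — the Caccioppoli bound above for the mollification by one smooth
  compactly supported kernel;
* `exists_L2_limit_mollifiedGradient` — for a bounded distributional solution on `Ω` of finite
  measure and a compact `K ⊆ Ω`, the truncated mollified gradients `𝟙_K D(kₙ ⋆ 𝟙_Ω u)` converge
  in `L²(ℝ × E)` to some `G̃ ∈ L²`.

## References

* G. Seregin, V. Šverák, Comm. PDE 34 (2009), arXiv:0804.1803, §2 p. 6, Remark 3.4.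
* L. Caffarelli, R. Kohn, L. Nirenberg, CPAM 35 (1982), §2.
* J. Serrin, *On the interior regularity of weak solutions of the Navier–Stokes equations*,
  Arch. Rational Mech. Anal. 9 (1962), §2.
-/

noncomputable section

open MeasureTheory TopologicalSpace Set Function Filter Topology ContinuousLinearMap Metric
  InnerProductSpace Module
open scoped ENNReal NNReal Convolution RealInnerProductSpace Laplacian

namespace Literature.Analysis.FluidPDE

/-! ### Young's inequality under the integral sign -/

section Young

variable {E : Type*} [NormedAddCommGroup E] [InnerProductSpace ℝ E] [FiniteDimensional ℝ E]

/-- Pointwise Young: `⟪L x, e⟫ ≤ (ε/2) |L|²_F + (2ε)⁻¹ ‖x‖²` for a unit vector `e`, `ε > 0`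
(the operator norm is dominated by the Frobenius norm). [folklore] -/
theorem inner_apply_le_frobeniusNormSq_add (L : E →L[ℝ] E) (x e : E) (he : ‖e‖ = 1) {ε : ℝ}
    (hε : 0 < ε) :
    ⟪L x, e⟫ ≤ ε / 2 * frobeniusNormSq L + 1 / (2 * ε) * ‖x‖ ^ 2 := by
  have h1 : ⟪L x, e⟫ ≤ ‖L‖ * ‖x‖ := by
    calc ⟪L x, e⟫ ≤ ‖L x‖ * ‖e‖ := real_inner_le_norm _ _
      _ = ‖L x‖ := by rw [he, mul_one]
      _ ≤ ‖L‖ * ‖x‖ := L.le_opNorm x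
  have h2 : ‖L‖ * ‖x‖ ≤ ε / 2 * ‖L‖ ^ 2 + 1 / (2 * ε) * ‖x‖ ^ 2 := by
    rw [show ε / 2 * ‖L‖ ^ 2 + 1 / (2 * ε) * ‖x‖ ^ 2 = ((ε * ‖L‖) ^ 2 + ‖x‖ ^ 2) / (2 * ε) by
      field_simp]
    rw [le_div_iff₀ (by positivity)]
    nlinarith [sq_nonneg (ε * ‖L‖ - ‖x‖)]
  have h3 : ε / 2 * ‖L‖ ^ 2 ≤ ε / 2 * frobeniusNormSq L :=
    mul_le_mul_of_nonneg_left (sq_opNorm_le_frobeniusNormSq L) (by positivity)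
  linarith

/-- **Young's inequality under the integral sign**: for a nonnegative weight `w`, a unit vector
`e` and `ε > 0`, `∫ w ⟪D(N), e⟫ ≤ (ε/2) ∫ w |D|²_F + (2ε)⁻¹ ∫ w ‖N‖²` (all three integrands being
integrable; the absorption step of every Caccioppoli estimate). [folklore] -/
theorem integral_weight_inner_apply_le {X : Type*} [MeasurableSpace X] {μ : Measure X}
    {w : X → ℝ} (hw0 : ∀ x, 0 ≤ w x) {D : X → E →L[ℝ] E} {N : X → E} {e : E} (he : ‖e‖ = 1)
    {ε : ℝ} (hε : 0 < ε) (h1 : Integrable (fun x => w x * ⟪D x (N x), e⟫) μ)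
    (h2 : Integrable (fun x => w x * frobeniusNormSq (D x)) μ)
    (h3 : Integrable (fun x => w x * ‖N x‖ ^ 2) μ) :
    ∫ x, w x * ⟪D x (N x), e⟫ ∂μ ≤
      ε / 2 * ∫ x, w x * frobeniusNormSq (D x) ∂μ + 1 / (2 * ε) * ∫ x, w x * ‖N x‖ ^ 2 ∂μ := by
  rw [← integral_const_mul, ← integral_const_mul, ← integral_add (h2.const_mul _) (h3.const_mul _)]
  refine integral_mono h1 ((h2.const_mul _).add (h3.const_mul _)) fun x => ?_
  have h := mul_le_mul_of_nonneg_left (inner_apply_le_frobeniusNormSq_add (D x) (N x) e he hε) (hw0 x)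
  calc w x * ⟪D x (N x), e⟫ ≤ w x * (ε / 2 * frobeniusNormSq (D x) + 1 / (2 * ε) * ‖N x‖ ^ 2) := h
    _ = ε / 2 * (w x * frobeniusNormSq (D x)) + 1 / (2 * ε) * (w x * ‖N x‖ ^ 2) := by ring

end Young

/-! ### The Caccioppoli bound for the mollification by one kernel -/

section Dissipation

variable {E : Type*} [NormedAddCommGroup E] [InnerProductSpace ℝ E] [FiniteDimensional ℝ E]
  [MeasurableSpace E] [BorelSpace E]
variable {ι : Type*} [Fintype ι]

/-- The dyadic field `uᵢ u` is integrable on `Ω` when `|u|²` is. [folklore] -/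
theorem integrableOn_inner_smul_self {Ω : Opens (ℝ × E)} {u : ℝ → E → E}
    (hu : IntegrableOn (uncurry u) (Ω : Set (ℝ × E)) volume)
    (hu2 : IntegrableOn (fun z => ‖uncurry u z‖ ^ 2) (Ω : Set (ℝ × E)) volume) (e : E) :
    IntegrableOn (uncurry fun s y => ⟪u s y, e⟫ • u s y) (Ω : Set (ℝ × E)) volume := by
  refine Integrable.mono' (hu2.mul_const ‖e‖) ?_ (Eventually.of_forall fun z => ?_)
  · exact (hu.aestronglyMeasurable.inner aestronglyMeasurable_const).smul hu.aestronglyMeasurable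
  · change ‖⟪u z.1 z.2, e⟫ • u z.1 z.2‖ ≤ ‖uncurry u z‖ ^ 2 * ‖e‖
    rw [norm_smul]
    calc ‖⟪u z.1 z.2, e⟫‖ * ‖u z.1 z.2‖ ≤ (‖u z.1 z.2‖ * ‖e‖) * ‖u z.1 z.2‖ := by
          gcongr; exact norm_inner_le_norm _ _
      _ = ‖uncurry u z‖ ^ 2 * ‖e‖ := by rw [show uncurry u z = u z.1 z.2 from rfl]; ring

set_option maxHeartbeats 800000 in
/-- **The Caccioppoli bound for the mollified system.** Let `(u, p)` be a distributional solution
of the unforced Navier–Stokes system (viscosity `ν > 0`) on an open `Ω ⊆ ℝ × E` with `u`, `|u|²`,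
`p` integrable on `Ω`; let `k` be a smooth kernel vanishing outside `closedBall 0 r`, `χ ≥ 0` a
space–time test function on `Ω` all of whose support points `z` have `closedBall z r ⊆ Ω`, and
`a ≤ t` times at which `χ` vanishes. Then the mollifications `V = k ⋆ 𝟙_Ω u`,
`Nᵢ = k ⋆ 𝟙_Ω (uᵢ u)`, `P = k ⋆ 𝟙_Ω p` satisfy, for every `ε > 0` with `(dim E) ε ≤ ν`,
`ν ∫∫ χ |DV|² ≤ ∫∫ |V|² (νΔχ + ∂ₜχ) + 2 Σᵢ ∫∫ ⟪Nᵢ, ∇χ⟫ Vᵢ + 2 ∫∫ P ⟪V, ∇χ⟫ + ε⁻¹ Σᵢ ∫∫ χ |Nᵢ|²`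
(integrals over `(a, t) × E`): the smooth local energy identity
(`local_energy_identity_smooth`, CKN 1982, §2) for the mollified system
(`IsDistributionalNSSolutionOn.mollified_momentum`), in which the slice term vanishes and the term
`2 Σᵢ ∫∫ χ ⟪DV(Nᵢ), bᵢ⟫` is absorbed by Young's inequality (Serrin 1962, §2). [cite: CaffarelliKohnNirenberg1982, §2] -/
theorem mollified_dissipation_le (b : OrthonormalBasis ι ℝ E) {ν : ℝ}
    {Ω : Opens (ℝ × E)} {u : ℝ → E → E} {p : ℝ → E → ℝ}
    (hNS : IsDistributionalNSSolutionOn Ω ν 0 u p)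
    (hu : IntegrableOn (uncurry u) (Ω : Set (ℝ × E)) volume)
    (hu2 : IntegrableOn (fun z => ‖uncurry u z‖ ^ 2) (Ω : Set (ℝ × E)) volume)
    (hpI : IntegrableOn (uncurry p) (Ω : Set (ℝ × E)) volume)
    {k : ℝ × E → ℝ} {r : ℝ} (hk : ContDiff ℝ (⊤ : ℕ∞) k)
    (hkr : ∀ w, w ∉ closedBall (0 : ℝ × E) r → k w = 0)
    {χ : ℝ → E → ℝ} (hχ : IsSpaceTimeTestOn Ω χ) (hχ0 : ∀ s y, 0 ≤ χ s y)
    (hr : ∀ z ∈ tsupport (uncurry χ), closedBall z r ⊆ (Ω : Set (ℝ × E)))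
    {a t : ℝ} (hat : a ≤ t) (hχa : ∀ y, χ a y = 0) (hχt : ∀ y, χ t y = 0)
    {ε : ℝ} (hε : 0 < ε) (hεν : (Fintype.card ι : ℝ) * ε ≤ ν) :
    ν * (∫ z in Ioo a t ×ˢ (univ : Set E), χ z.1 z.2 *
        frobeniusNormSq (fderiv ℝ (stMollify k (zeroExt Ω u) z.1) z.2)) ≤
      (∫ z in Ioo a t ×ˢ (univ : Set E), ‖stMollify k (zeroExt Ω u) z.1 z.2‖ ^ 2 *
          (ν * (Δ (χ z.1)) z.2 + timeDeriv χ z.1 z.2)) +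
      2 * (∑ i, ∫ z in Ioo a t ×ˢ (univ : Set E),
          ⟪stMollify k (zeroExt Ω fun s y => ⟪u s y, b i⟫ • u s y) z.1 z.2, gradient (χ z.1) z.2⟫ *
            ⟪stMollify k (zeroExt Ω u) z.1 z.2, b i⟫) +
      2 * (∫ z in Ioo a t ×ˢ (univ : Set E),
          stMollify k (zeroExt Ω p) z.1 z.2 *
            ⟪stMollify k (zeroExt Ω u) z.1 z.2, gradient (χ z.1) z.2⟫) +
      ε⁻¹ * (∑ i, ∫ z in Ioo a t ×ˢ (univ : Set E),
          χ z.1 z.2 * ‖stMollify k (zeroExt Ω fun s y => ⟪u s y, b i⟫ • u s y) z.1 z.2‖ ^ 2) := by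
  haveI : (volume : Measure (ℝ × E)).IsAddHaarMeasure := Measure.prod.instIsAddHaarMeasure _ _
  -- names
  set ũ : ℝ × E → E := zeroExt Ω u with hũ
  set pt : ℝ × E → ℝ := zeroExt Ω p with hpt
  set Nt : ι → ℝ × E → E := fun i => zeroExt Ω fun s y => ⟪u s y, b i⟫ • u s y with hNt
  set V : ℝ → E → E := stMollify k ũ with hV
  set P : ℝ → E → ℝ := stMollify k pt with hP
  set N : ι → ℝ → E → E := fun i => stMollify k (Nt i) with hN
  set S : Set (ℝ × E) := Ioo a t ×ˢ (univ : Set E) with hS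
  change ν * (∫ z in S, χ z.1 z.2 * frobeniusNormSq (fderiv ℝ (V z.1) z.2)) ≤
      (∫ z in S, ‖V z.1 z.2‖ ^ 2 * (ν * (Δ (χ z.1)) z.2 + timeDeriv χ z.1 z.2)) +
      2 * (∑ i, ∫ z in S, ⟪N i z.1 z.2, gradient (χ z.1) z.2⟫ * ⟪V z.1 z.2, b i⟫) +
      2 * (∫ z in S, P z.1 z.2 * ⟪V z.1 z.2, gradient (χ z.1) z.2⟫) +
      ε⁻¹ * (∑ i, ∫ z in S, χ z.1 z.2 * ‖N i z.1 z.2‖ ^ 2)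
  -- local integrability of the zero extensions, smoothness of the mollified fields
  have hkc : HasCompactSupport k := hasCompactSupport_of_closedBall hkr
  have hũi : LocallyIntegrable ũ volume := locallyIntegrable_zeroExt hu
  have hpti : LocallyIntegrable pt volume := locallyIntegrable_zeroExt hpI
  have hNtli : ∀ i, LocallyIntegrable (Nt i) volume := fun i =>
    locallyIntegrable_zeroExt (integrableOn_inner_smul_self hu hu2 (b i))
  have hVsm : ContDiff ℝ (⊤ : ℕ∞) (uncurry V) := contDiff_uncurry_stMollify hk hkc hũi
  have hPsm : ContDiff ℝ (⊤ : ℕ∞) (uncurry P) := contDiff_uncurry_stMollify hk hkc hpti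
  have hNsm : ∀ i, ContDiff ℝ (⊤ : ℕ∞) (uncurry (N i)) := fun i =>
    contDiff_uncurry_stMollify hk hkc (hNtli i)
  -- the mollified equations on the support of `χ`
  have hEQ : ∀ s y, χ s y ≠ 0 →
      (∀ i, ⟪timeDeriv V s y, b i⟫ + VectorCalculus.divergence (N i s) y - ν * ⟪(Δ (V s)) y, b i⟫ +
        fderiv ℝ (P s) y (b i) = 0) ∧ VectorCalculus.divergence (V s) y = 0 := by
    intro s y hy
    have hz : (s, y) ∈ tsupport (uncurry χ) := subset_tsupport _ (by exact hy)
    have hsub := hr _ hz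
    exact ⟨fun i => hNS.mollified_momentum hu hu2 hpI hk hkr hsub (b i),
      hNS.divergence_mollified_eq_zero hu hk hkr hsub⟩
  -- the smooth local energy identity, with vanishing slice term
  have hID := local_energy_identity_smooth b (ν := ν) hat hVsm hNsm hPsm hχ hχa
    (fun s _ y hy => (hEQ s y hy).1) (fun s _ y hy => (hEQ s y hy).2)
  have h0 : ∫ y, χ t y * ‖V t y‖ ^ 2 = 0 := by simp [hχt]
  rw [h0, zero_add] at hID
  -- continuity of the fields and weights
  have sV : IsSmoothSpaceTimeOn univ V := hVsm.contDiffOn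
  have sχ : IsSmoothSpaceTimeOn univ χ := hχ.isSmoothSpaceTimeOn univ
  have cV : Continuous (uncurry V) := hVsm.continuous
  have cP : Continuous (uncurry P) := hPsm.continuous
  have cN : ∀ i, Continuous (uncurry (N i)) := fun i => (hNsm i).continuous
  have cDV : Continuous (uncurry fun s y => fderiv ℝ (V s) y) :=
    (sV.fderiv_slice uniqueDiffOn_univ).continuous_uncurry
  have cχ : Continuous (uncurry χ) := hχ.contDiff.continuous
  have cgχ : Continuous (uncurry fun s y => gradient (χ s) y) :=
    (sχ.gradient uniqueDiffOn_univ).continuous_uncurry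
  have cΔχ : Continuous (uncurry fun s y => (Δ (χ s)) y) :=
    (sχ.laplacian uniqueDiffOn_univ).continuous_uncurry
  have cTχ : Continuous (uncurry (timeDeriv χ)) := hχ.continuous_timeDeriv
  -- the compact support `Kχ` and vanishing of the weights off it
  set Kχ : Set (ℝ × E) := tsupport (uncurry χ) with hKχ
  have hKc : IsCompact Kχ := hχ.hasCompactSupport
  have hw0 : ∀ z, z ∉ Kχ → χ z.1 z.2 = 0 ∧ gradient (χ z.1) z.2 = 0 ∧ (Δ (χ z.1)) z.2 = 0 ∧
      timeDeriv χ z.1 z.2 = 0 := fun z hz => weights_eq_zero_of_notMem_tsupport hz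
  -- the integrands
  set f1 : ℝ × E → ℝ := fun z => ‖V z.1 z.2‖ ^ 2 * (ν * (Δ (χ z.1)) z.2 + timeDeriv χ z.1 z.2)
    with hf1
  set f2a : ι → ℝ × E → ℝ := fun i z => ⟪N i z.1 z.2, gradient (χ z.1) z.2⟫ * ⟪V z.1 z.2, b i⟫
    with hf2a
  set f2b : ι → ℝ × E → ℝ := fun i z => χ z.1 z.2 * ⟪fderiv ℝ (V z.1) z.2 (N i z.1 z.2), b i⟫
    with hf2b
  set f3 : ℝ × E → ℝ := fun z => P z.1 z.2 * ⟪V z.1 z.2, gradient (χ z.1) z.2⟫ with hf3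
  set fX : ℝ × E → ℝ := fun z => χ z.1 z.2 * frobeniusNormSq (fderiv ℝ (V z.1) z.2) with hfX
  set fY : ι → ℝ × E → ℝ := fun i z => χ z.1 z.2 * ‖N i z.1 z.2‖ ^ 2 with hfY
  -- continuity
  have cf1 : Continuous f1 := ((cV.norm).pow 2).mul ((continuous_const.mul cΔχ).add cTχ)
  have cf2a : ∀ i, Continuous (f2a i) := fun i =>
    ((cN i).inner cgχ).mul (cV.inner continuous_const)
  have cf2b : ∀ i, Continuous (f2b i) := fun i =>
    cχ.mul ((isBoundedBilinearMap_apply.continuous.comp (cDV.prodMk (cN i))).inner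
      continuous_const)
  have cf3 : Continuous f3 := cP.mul (cV.inner cgχ)
  have cfX : Continuous fX := cχ.mul (LerayHopfProofs.continuous_frobeniusNormSq.comp cDV)
  have cfY : ∀ i, Continuous (fY i) := fun i => cχ.mul (((cN i).norm).pow 2)
  -- compact support
  have sf1 : HasCompactSupport f1 := HasCompactSupport.intro hKc fun z hz => by
    simp only [hf1, (hw0 z hz).2.2.1, (hw0 z hz).2.2.2, mul_zero, add_zero]
  have sf2a : ∀ i, HasCompactSupport (f2a i) := fun i => HasCompactSupport.intro hKc fun z hz => by
    simp only [hf2a, (hw0 z hz).2.1, inner_zero_right, zero_mul]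
  have sf2b : ∀ i, HasCompactSupport (f2b i) := fun i => HasCompactSupport.intro hKc fun z hz => by
    simp only [hf2b, (hw0 z hz).1, zero_mul]
  have sf3 : HasCompactSupport f3 := HasCompactSupport.intro hKc fun z hz => by
    simp only [hf3, (hw0 z hz).2.1, inner_zero_right, mul_zero]
  have sfX : HasCompactSupport fX := HasCompactSupport.intro hKc fun z hz => by
    simp only [hfX, (hw0 z hz).1, zero_mul]
  have sfY : ∀ i, HasCompactSupport (fY i) := fun i => HasCompactSupport.intro hKc fun z hz => by
    simp only [hfY, (hw0 z hz).1, zero_mul]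
  -- integrability on `S`
  have if1 : Integrable f1 (volume.restrict S) := (cf1.integrable_of_hasCompactSupport sf1).integrableOn
  have if2a : ∀ i, Integrable (f2a i) (volume.restrict S) := fun i =>
    ((cf2a i).integrable_of_hasCompactSupport (sf2a i)).integrableOn
  have if2b : ∀ i, Integrable (f2b i) (volume.restrict S) := fun i =>
    ((cf2b i).integrable_of_hasCompactSupport (sf2b i)).integrableOn
  have if3 : Integrable f3 (volume.restrict S) := (cf3.integrable_of_hasCompactSupport sf3).integrableOn
  have ifX : Integrable fX (volume.restrict S) := (cfX.integrable_of_hasCompactSupport sfX).integrableOn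
  have ifY : ∀ i, Integrable (fY i) (volume.restrict S) := fun i =>
    ((cfY i).integrable_of_hasCompactSupport (sfY i)).integrableOn
  -- splitting the right-hand side of the identity
  have eR : ∫ z in S, (‖V z.1 z.2‖ ^ 2 * (ν * (Δ (χ z.1)) z.2 + timeDeriv χ z.1 z.2) +
      2 * (∑ i, (⟪N i z.1 z.2, gradient (χ z.1) z.2⟫ * ⟪V z.1 z.2, b i⟫ +
        χ z.1 z.2 * ⟪fderiv ℝ (V z.1) z.2 (N i z.1 z.2), b i⟫)) +
      2 * (P z.1 z.2 * ⟪V z.1 z.2, gradient (χ z.1) z.2⟫)) =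
      (∫ z in S, f1 z) + 2 * ((∑ i, ∫ z in S, f2a i z) + ∑ i, ∫ z in S, f2b i z) +
        2 * ∫ z in S, f3 z := by
    have iS : Integrable (fun z => ∑ i, (f2a i z + f2b i z)) (volume.restrict S) :=
      integrable_finsetSum _ fun i _ => (if2a i).add (if2b i)
    have i2 : Integrable (fun z => 2 * ∑ i, (f2a i z + f2b i z)) (volume.restrict S) :=
      iS.const_mul 2
    have i3 : Integrable (fun z => 2 * f3 z) (volume.restrict S) := if3.const_mul 2
    have i12 : Integrable (fun z => f1 z + 2 * ∑ i, (f2a i z + f2b i z)) (volume.restrict S) :=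
      if1.add i2
    have iTi : ∀ i ∈ Finset.univ, Integrable (fun z => f2a i z + f2b i z) (volume.restrict S) :=
      fun i _ => (if2a i).add (if2b i)
    change ∫ z in S, (f1 z + 2 * ∑ i, (f2a i z + f2b i z) + 2 * f3 z) = _
    rw [integral_add i12 i3, integral_add if1 i2, integral_const_mul, integral_const_mul,
      integral_finsetSum _ iTi]
    congr 2
    congr 1
    rw [← Finset.sum_add_distrib]
    refine Finset.sum_congr rfl fun i _ => ?_
    exact integral_add (if2a i) (if2b i)
  rw [eR] at hID
  change 2 * ν * ∫ z in S, fX z = _ at hID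
  -- Young's inequality on the terms `f2b`
  have hY : ∀ i, (∫ z in S, f2b i z) ≤
      ε / 2 * (∫ z in S, fX z) + 1 / (2 * ε) * (∫ z in S, fY i z) := fun i =>
    integral_weight_inner_apply_le (μ := volume.restrict S) (w := fun z : ℝ × E => χ z.1 z.2)
      (fun z => hχ0 z.1 z.2) (D := fun z : ℝ × E => fderiv ℝ (V z.1) z.2)
      (N := fun z : ℝ × E => N i z.1 z.2) (b.orthonormal.1 i) hε (if2b i) ifX (ifY i)
  have hYsum : (∑ i, ∫ z in S, f2b i z) ≤
      (Fintype.card ι : ℝ) * (ε / 2 * (∫ z in S, fX z)) +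
        1 / (2 * ε) * (∑ i, ∫ z in S, fY i z) := by
    calc (∑ i, ∫ z in S, f2b i z)
        ≤ ∑ i, (ε / 2 * (∫ z in S, fX z) + 1 / (2 * ε) * (∫ z in S, fY i z)) :=
          Finset.sum_le_sum fun i _ => hY i
      _ = (Fintype.card ι : ℝ) * (ε / 2 * (∫ z in S, fX z)) +
            1 / (2 * ε) * (∑ i, ∫ z in S, fY i z) := by
          rw [Finset.sum_add_distrib, Finset.sum_const, Finset.card_univ, nsmul_eq_mul,
            Finset.mul_sum]
  -- nonnegativity of the dissipation
  have hX0 : 0 ≤ ∫ z in S, fX z :=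
    setIntegral_nonneg (measurableSet_Ioo.prod MeasurableSet.univ) fun z _ =>
      mul_nonneg (hχ0 z.1 z.2) (frobeniusNormSq_nonneg _)
  have hcard : (Fintype.card ι : ℝ) * ε * (∫ z in S, fX z) ≤ ν * (∫ z in S, fX z) :=
    mul_le_mul_of_nonneg_right hεν hX0
  -- conclusion
  change ν * (∫ z in S, fX z) ≤ (∫ z in S, f1 z) + 2 * (∑ i, ∫ z in S, f2a i z) +
    2 * (∫ z in S, f3 z) + ε⁻¹ * (∑ i, ∫ z in S, fY i z)
  set X : ℝ := ∫ z in S, fX z with hXdef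
  set A : ℝ := ∑ i, ∫ z in S, f2a i z with hAdef
  set B : ℝ := ∑ i, ∫ z in S, f2b i z with hBdef
  set Y : ℝ := ∑ i, ∫ z in S, fY i z with hYdef
  set T1 : ℝ := ∫ z in S, f1 z with hT1def
  set T3 : ℝ := ∫ z in S, f3 z with hT3def
  set c : ℝ := 1 / (2 * ε) with hcdef
  have hεid : ε⁻¹ = 2 * c := by rw [hcdef]; field_simp
  rw [hεid]
  have hB : 2 * B ≤ (Fintype.card ι : ℝ) * ε * X + 2 * c * Y := by nlinarith [hYsum]
  nlinarith [hID, hB, hcard, hX0]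

end Dissipation

/-! ### The truncated mollified gradients form a Cauchy sequence in `L²` -/

section Cauchy

variable {E : Type*} [NormedAddCommGroup E] [InnerProductSpace ℝ E] [FiniteDimensional ℝ E]
  [MeasurableSpace E] [BorelSpace E]

/-- A continuous field truncated to a compact set is in every `L^p(ℝ × E)`. [folklore] -/
theorem memLp_indicator_of_continuous {F : Type*} [NormedAddCommGroup F] {f : ℝ × E → F}
    (hf : Continuous f) {K : Set (ℝ × E)} (hK : IsCompact K) (q : ℝ≥0∞) :
    MemLp (K.indicator f) q (volume : Measure (ℝ × E)) := by
  have hKm : MeasurableSet K := hK.isClosed.measurableSet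
  rw [memLp_indicator_iff_restrict hKm]
  haveI : IsFiniteMeasure ((volume : Measure (ℝ × E)).restrict K) :=
    isFiniteMeasure_restrict.2 hK.measure_lt_top.ne
  obtain ⟨C, hC⟩ := hK.exists_bound_of_continuousOn hf.continuousOn
  have htop : MemLp f ∞ ((volume : Measure (ℝ × E)).restrict K) :=
    memLp_top_of_bound hf.aestronglyMeasurable.restrict C
      (ae_restrict_of_forall_mem hKm fun z hz => hC z hz)
  exact htop.mono_exponent le_top

omit [FiniteDimensional ℝ E] [MeasurableSpace E] [BorelSpace E] [InnerProductSpace ℝ E]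
  [NormedAddCommGroup E] in
/-- `Prod.fst` tends to `atTop` along `atTop` on `ℕ × ℕ`. [folklore] -/
theorem tendsto_fst_atTop_prod : Tendsto (fun mn : ℕ × ℕ => mn.1) atTop atTop := by
  rw [← prod_atTop_atTop_eq]; exact tendsto_fst

omit [FiniteDimensional ℝ E] [MeasurableSpace E] [BorelSpace E] [InnerProductSpace ℝ E]
  [NormedAddCommGroup E] in
/-- `Prod.snd` tends to `atTop` along `atTop` on `ℕ × ℕ`. [folklore] -/
theorem tendsto_snd_atTop_prod : Tendsto (fun mn : ℕ × ℕ => mn.2) atTop atTop := by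
  rw [← prod_atTop_atTop_eq]; exact tendsto_snd

omit [MeasurableSpace E] [BorelSpace E] in
/-- The pointwise comparison behind the `L²` Cauchy estimate: the squared norm of a difference
of truncated fields is dominated by the cut-off-weighted Frobenius norm of the difference,
when the cut-off is `1` on the truncation set. [folklore] -/
theorem enorm_indicator_sub_sq_le {K : Set (ℝ × E)} {D₁ D₂ : ℝ × E → E →L[ℝ] E} {w : ℝ × E → ℝ}
    (hw1 : ∀ z ∈ K, w z = 1) (z : ℝ × E) :
    ‖(K.indicator D₁ - K.indicator D₂) z‖ₑ ^ 2 ≤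
      ENNReal.ofReal (w z * frobeniusNormSq (D₁ z - D₂ z)) := by
  by_cases hz : z ∈ K
  · rw [Pi.sub_apply, indicator_of_mem hz, indicator_of_mem hz, hw1 z hz, one_mul,
      ← ofReal_norm, ← ENNReal.ofReal_pow (norm_nonneg _)]
    exact ENNReal.ofReal_le_ofReal (sq_opNorm_le_frobeniusNormSq _)
  · simp [indicator_of_notMem hz, enorm_eq_nnnorm]

set_option maxHeartbeats 1600000 in
/-- **The truncated mollified gradients of a bounded distributional solution converge in `L²`.**
Let `(u, p)` solve the unforced Navier–Stokes system (viscosity `ν > 0`) in the sense of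
distributions on an open `Ω ⊆ ℝ × E` of finite measure, with `‖u‖ ≤ M` a.e. on `Ω` and
`p ∈ L^{3/2}(Ω)`, let `kₙ` be normalised bump kernels with radii `→ 0`, and `K ⊆ Ω` compact.
Then there is `G̃ ∈ L²(ℝ × E; E →L E)` with `𝟙_K D(kₙ ⋆ 𝟙_Ω u) → G̃` in `L²(ℝ × E)`: by
`mollified_dissipation_le` applied to the difference kernels `kₘ - kₙ` and a cut-off `χ = 1` on
`K`, together with the `L²`/`L³`/`L^{3/2}` convergence of the mollifications, the sequence is
Cauchy in the complete space `L²` (Serrin 1962, §2; the `∇v ∈ L₂` half of Seregin–Šverák 2009,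
§2 p. 6, "it is certainly true in `B × ]-1,-a²[`"). [cite: SereginSverak2009, §2 p. 6 and Remark 3.4] -/
theorem exists_L2_limit_mollifiedGradient {ν : ℝ} (hν : 0 < ν)
    {Ω : Opens (ℝ × E)} {u : ℝ → E → E} {p : ℝ → E → ℝ}
    (hNS : IsDistributionalNSSolutionOn Ω ν 0 u p)
    (hΩ : volume (Ω : Set (ℝ × E)) < ∞)
    {M : ℝ} (hM : ∀ᵐ z ∂(volume.restrict (Ω : Set (ℝ × E))), ‖u z.1 z.2‖ ≤ M)
    (hp : ∫⁻ z in (Ω : Set (ℝ × E)), ‖p z.1 z.2‖ₑ ^ (3 / 2 : ℝ) < ∞)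
    {bump : ℕ → ContDiffBump (0 : ℝ × E)} (hbr : Tendsto (fun n => (bump n).rOut) atTop (𝓝 0))
    {K : Set (ℝ × E)} (hK : IsCompact K) (hKΩ : K ⊆ (Ω : Set (ℝ × E))) :
    ∃ Gt : ℝ × E → E →L[ℝ] E, MemLp Gt 2 volume ∧
      Tendsto (fun n => eLpNorm (K.indicator (fun z : ℝ × E =>
        fderiv ℝ (stMollify ((bump n).normed volume) (zeroExt Ω u) z.1) z.2) - Gt) 2 volume)
        atTop (𝓝 0) := by
  haveI : (volume : Measure (ℝ × E)).IsAddHaarMeasure := Measure.prod.instIsAddHaarMeasure _ _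
  -- small constants in `ℝ≥0∞`
  have one_le_three_halves : (1 : ℝ≥0∞) ≤ 3 / 2 := by
    have h : (1 : ℝ≥0∞) = 2 / 2 := (ENNReal.div_self two_ne_zero ENNReal.ofNat_ne_top).symm
    rw [h]
    gcongr
    norm_num
  have three_halves_ne_top : (3 / 2 : ℝ≥0∞) ≠ ∞ := ENNReal.div_ne_top (by norm_num) (by norm_num)
  have three_halves_ne_zero : (3 / 2 : ℝ≥0∞) ≠ 0 :=
    (ENNReal.div_pos (by norm_num) (by norm_num)).ne'
  haveI hHT442 : ENNReal.HolderTriple 4 4 2 := by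
    simpa using holderTriple_ofReal (a := 4) (b := 4) (c := 2) (by norm_num) (by norm_num)
      (by norm_num) (by norm_num)
  haveI hHT31 : ENNReal.HolderTriple (3 / 2) 3 1 := by
    have h := holderTriple_ofReal (a := 3 / 2) (b := 3) (c := 1) (by norm_num) (by norm_num)
      (by norm_num) (by norm_num)
    rwa [ENNReal.ofReal_ofNat, ENNReal.ofReal_div_of_pos (by norm_num), ENNReal.ofReal_ofNat,
      ENNReal.ofReal_ofNat, ENNReal.ofReal_one] at h
  haveI hHT22 : ENNReal.HolderTriple 2 2 1 := ENNReal.HolderConjugate.instTwoTwo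
  set b := stdOrthonormalBasis ℝ E with hb
  -- ## (0) the classes of `u`, `p` on `Ω`
  have hQm : MeasurableSet (Ω : Set (ℝ × E)) := Ω.isOpen.measurableSet
  haveI : IsFiniteMeasure (volume.restrict (Ω : Set (ℝ × E))) :=
    ⟨by rwa [Measure.restrict_apply_univ]⟩
  have hvm : AEStronglyMeasurable (uncurry u) (volume.restrict (Ω : Set (ℝ × E))) :=
    hNS.1.aestronglyMeasurable
  have hpm : AEStronglyMeasurable (uncurry p) (volume.restrict (Ω : Set (ℝ × E))) :=
    hNS.2.2.1.aestronglyMeasurable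
  have huinf : MemLp (uncurry u) ∞ (volume.restrict (Ω : Set (ℝ × E))) :=
    memLp_top_of_bound hvm M hM
  have hu2Q : MemLp (uncurry u) 2 (volume.restrict (Ω : Set (ℝ × E))) := huinf.mono_exponent le_top
  have hu3Q : MemLp (uncurry u) 3 (volume.restrict (Ω : Set (ℝ × E))) := huinf.mono_exponent le_top
  have hu4Q : MemLp (uncurry u) 4 (volume.restrict (Ω : Set (ℝ × E))) := huinf.mono_exponent le_top
  have hpQ : MemLp (uncurry p) (3 / 2) (volume.restrict (Ω : Set (ℝ × E))) := by
    refine memLp_of_lintegral_rpow_lt_top three_halves_ne_zero three_halves_ne_top hpm ?_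
    have : ((3 : ℝ≥0∞) / 2).toReal = 3 / 2 := by
      rw [ENNReal.toReal_div]; norm_num
    rw [this]
    exact hp
  have huI : IntegrableOn (uncurry u) (Ω : Set (ℝ × E)) volume := hu2Q.integrable one_le_two
  have hu2I : IntegrableOn (fun z => ‖uncurry u z‖ ^ 2) (Ω : Set (ℝ × E)) volume :=
    hu2Q.integrable_norm_pow two_ne_zero
  have hpI : IntegrableOn (uncurry p) (Ω : Set (ℝ × E)) volume := hpQ.integrable one_le_three_halves
  -- ## (1) the zero extensions and their whole-space classes
  set ũ : ℝ × E → E := zeroExt Ω u with hũ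
  set pt : ℝ × E → ℝ := zeroExt Ω p with hpt
  set Nt : Fin (finrank ℝ E) → ℝ × E → E := fun i => zeroExt Ω fun s y => ⟪u s y, b i⟫ • u s y
    with hNt
  have hũ2 : MemLp ũ 2 volume := memLp_zeroExt rfl hQm hu2Q
  have hũ3 : MemLp ũ 3 volume := memLp_zeroExt rfl hQm hu3Q
  have hũ4 : MemLp ũ 4 volume := memLp_zeroExt rfl hQm hu4Q
  have hpt32 : MemLp pt (3 / 2) volume := memLp_zeroExt rfl hQm hpQ
  have hNt' : ∀ i, Nt i = fun z => ⟪ũ z, b i⟫ • ũ z := fun i => by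
    rw [hNt]; exact zeroExt_inner_smul u (b i)
  have hNt2 : ∀ i, MemLp (Nt i) 2 volume := fun i => by
    have := memLp_bilin (p := 4) (q := 4) (r := 2) (innerSmulBilin (b i)) hũ4 hũ4
    simpa [hNt' i] using this
  have hũi : LocallyIntegrable ũ volume := locallyIntegrable_zeroExt huI
  have hpti : LocallyIntegrable pt volume := locallyIntegrable_zeroExt hpI
  have hNtli : ∀ i, LocallyIntegrable (Nt i) volume := fun i =>
    locallyIntegrable_zeroExt (integrableOn_inner_smul_self huI hu2I (b i))
  -- ## (2) the mollifiers and the mollified fields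
  set k : ℕ → ℝ × E → ℝ := fun n => (bump n).normed volume with hk
  have hkinf : ∀ n, ContDiff ℝ (⊤ : ℕ∞) (k n) := fun n => (bump n).contDiff_normed
  have hkr : ∀ n w, w ∉ closedBall (0 : ℝ × E) (bump n).rOut → k n w = 0 := fun n w hw => by
    have : w ∉ Function.support (k n) := by
      rw [hk, (bump n).support_normed_eq]; exact fun h => hw (ball_subset_closedBall h)
    simpa using this
  have hkc : ∀ n, HasCompactSupport (k n) := fun n => (bump n).hasCompactSupport_normed
  set V : ℕ → ℝ → E → E := fun n => stMollify (k n) ũ with hV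
  set Pm : ℕ → ℝ → E → ℝ := fun n => stMollify (k n) pt with hPm
  set N : ℕ → Fin (finrank ℝ E) → ℝ → E → E := fun n i => stMollify (k n) (Nt i) with hN
  set D : ℕ → ℝ × E → E →L[ℝ] E := fun n z => fderiv ℝ (V n z.1) z.2 with hD
  have hVsm : ∀ n, ContDiff ℝ (⊤ : ℕ∞) (uncurry (V n)) := fun n =>
    contDiff_uncurry_stMollify (hkinf n) (hkc n) hũi
  have hDc : ∀ n, Continuous (D n) := fun n => by
    have sV : IsSmoothSpaceTimeOn univ (V n) := (hVsm n).contDiffOn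
    exact (sV.fderiv_slice uniqueDiffOn_univ).continuous_uncurry
  have hDdiff : ∀ n (z : ℝ × E), DifferentiableAt ℝ (V n z.1) z.2 := fun n z =>
    ((contDiff_stMollify_slice (hkinf n) (hkc n) hũi z.1).differentiable (by simp)).differentiableAt
  -- whole-space convergence and classes of the mollifications
  have cV2 : Tendsto (fun n => eLpNorm (uncurry (V n) - ũ) 2 volume) atTop (𝓝 0) :=
    FunctionSpaces.tendsto_eLpNorm_normed_convolution_sub_self hbr (by norm_num) (by norm_num) hũ2
  have cV3 : Tendsto (fun n => eLpNorm (uncurry (V n) - ũ) 3 volume) atTop (𝓝 0) :=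
    FunctionSpaces.tendsto_eLpNorm_normed_convolution_sub_self hbr (by norm_num) (by norm_num) hũ3
  have cP : Tendsto (fun n => eLpNorm (uncurry (Pm n) - pt) (3 / 2) volume) atTop (𝓝 0) :=
    FunctionSpaces.tendsto_eLpNorm_normed_convolution_sub_self hbr one_le_three_halves
      three_halves_ne_top hpt32
  have cN : ∀ i, Tendsto (fun n => eLpNorm (uncurry (N n i) - Nt i) 2 volume) atTop (𝓝 0) :=
    fun i => FunctionSpaces.tendsto_eLpNorm_normed_convolution_sub_self hbr (by norm_num)
      (by norm_num) (hNt2 i)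
  have mV2 : ∀ n, MemLp (uncurry (V n)) 2 volume := fun n =>
    UnboundedOperators.memLp_convolution_lsmul (bump n).integrable_normed hũ2 (by norm_num)
  have mV3 : ∀ n, MemLp (uncurry (V n)) 3 volume := fun n =>
    UnboundedOperators.memLp_convolution_lsmul (bump n).integrable_normed hũ3 (by norm_num)
  have mP : ∀ n, MemLp (uncurry (Pm n)) (3 / 2) volume := fun n =>
    UnboundedOperators.memLp_convolution_lsmul (bump n).integrable_normed hpt32 one_le_three_halves
  have mN : ∀ n i, MemLp (uncurry (N n i)) 2 volume := fun n i =>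
    UnboundedOperators.memLp_convolution_lsmul (bump n).integrable_normed (hNt2 i) (by norm_num)
  -- ## (3) the cut-off and the margins
  obtain ⟨χu, hχu_smooth, hχu_cpt, hχu_sub, hχu_one, hχu_01⟩ :=
    FunctionSpaces.exists_smooth_cutoff_mem_Icc hK Ω.isOpen hKΩ
  set χ : ℝ → E → ℝ := fun s y => χu (s, y) with hχdef
  have hχ : IsSpaceTimeTestOn Ω χ := ⟨hχu_smooth, hχu_cpt, hχu_sub⟩
  have hχ0 : ∀ s y, 0 ≤ χ s y := fun s y => (hχu_01 (s, y)).1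
  have hχ1 : ∀ z ∈ K, χ z.1 z.2 = 1 := fun z hz => hχu_one z hz
  obtain ⟨δ, hδ, hδΩ⟩ := hχu_cpt.isCompact.exists_cthickening_subset_open Ω.isOpen hχu_sub
  have hball : ∀ z ∈ tsupport (uncurry χ), ∀ ρ, ρ ≤ δ →
      closedBall z ρ ⊆ (Ω : Set (ℝ × E)) := fun z hz ρ hρ =>
    ((closedBall_subset_cthickening hz ρ).trans (cthickening_mono hρ _)).trans hδΩ
  obtain ⟨a₀, b₀, hab⟩ : ∃ a₀ b₀ : ℝ, ∀ s, s ∉ Icc a₀ b₀ → χ s = 0 := by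
    have h1 : IsCompact (Prod.fst '' tsupport (uncurry χ)) :=
      hχ.hasCompactSupport.image continuous_fst
    obtain ⟨b₀, hb₀⟩ := h1.isBounded.bddAbove
    obtain ⟨a₀, ha₀⟩ := h1.isBounded.bddBelow
    refine ⟨a₀, b₀, fun s hs => funext fun y => ?_⟩
    by_contra hy
    have hmem : (s, y) ∈ tsupport (uncurry χ) := subset_tsupport _ hy
    exact hs ⟨ha₀ ⟨(s, y), hmem, rfl⟩, hb₀ ⟨(s, y), hmem, rfl⟩⟩
  set a : ℝ := a₀ - 1 with ha
  set t : ℝ := max a₀ b₀ + 1 with ht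
  have hat : a ≤ t := by
    rw [ha, ht]; linarith [le_max_left a₀ b₀]
  have hχa : ∀ y, χ a y = 0 := fun y => by
    have h := hab a (fun h => by rw [ha] at h; linarith [h.1])
    exact congrFun h y
  have hχt : ∀ y, χ t y = 0 := fun y => by
    have h := hab t (fun h => by rw [ht] at h; linarith [h.2, le_max_right a₀ b₀])
    exact congrFun h y
  have hχS : ∀ z : ℝ × E, z ∉ Ioo a t ×ˢ (univ : Set E) → χ z.1 z.2 = 0 := fun z hz => by
    have hz' : z.1 ∉ Ioo a t := fun h => hz ⟨h, mem_univ _⟩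
    have h := hab z.1 (fun h => hz' ⟨by rw [ha]; linarith [h.1],
      by rw [ht]; linarith [h.2, le_max_right a₀ b₀]⟩)
    exact congrFun h z.2
  set S : Set (ℝ × E) := Ioo a t ×ˢ (univ : Set E) with hS
  have hSm : MeasurableSet S := measurableSet_Ioo.prod MeasurableSet.univ
  -- weights and their bounds
  have sχ : IsSmoothSpaceTimeOn univ χ := hχ.isSmoothSpaceTimeOn univ
  have cχ : Continuous (uncurry χ) := hχ.contDiff.continuous
  have cgχ : Continuous (uncurry fun s y => gradient (χ s) y) :=
    (sχ.gradient uniqueDiffOn_univ).continuous_uncurry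
  have cΔχ : Continuous (uncurry fun s y => (Δ (χ s)) y) :=
    (sχ.laplacian uniqueDiffOn_univ).continuous_uncurry
  have cTχ : Continuous (uncurry (timeDeriv χ)) := hχ.continuous_timeDeriv
  set wΔ : ℝ × E → ℝ := fun z => ν * (Δ (χ z.1)) z.2 + timeDeriv χ z.1 z.2 with hwΔ
  set wχ : ℝ × E → ℝ := fun z => χ z.1 z.2 with hwχ
  set wg : ℝ × E → E →L[ℝ] ℝ := fun z => innerSL ℝ (gradient (χ z.1) z.2) with hwg
  have cwΔ : Continuous wΔ := (continuous_const.mul cΔχ).add cTχ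
  have cwg : Continuous wg := (innerSL ℝ).continuous.comp cgχ
  have hsuppχ : HasCompactSupport (uncurry χ) := hχ.hasCompactSupport
  have hw0 : ∀ z, z ∉ tsupport (uncurry χ) → wχ z = 0 ∧ wg z = 0 ∧ wΔ z = 0 := fun z hz => by
    obtain ⟨h1, h2, h3, h4⟩ := weights_eq_zero_of_notMem_tsupport hz
    refine ⟨h1, ?_, ?_⟩
    · simp only [hwg, h2, map_zero]
    · simp only [hwΔ, h3, h4, mul_zero, add_zero]
  obtain ⟨CΔ, hCΔ⟩ := cwΔ.bounded_above_of_compact_support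
    (hsuppχ.mono' fun z hz => by by_contra h; exact hz (hw0 z h).2.2)
  obtain ⟨Cχ, hCχ⟩ := cχ.bounded_above_of_compact_support hsuppχ
  obtain ⟨Cg, hCg⟩ := cwg.bounded_above_of_compact_support
    (hsuppχ.mono' fun z hz => by by_contra h; exact hz (hw0 z h).2.1)
  have mwΔ : AEStronglyMeasurable wΔ volume := cwΔ.aestronglyMeasurable
  have mwχ : AEStronglyMeasurable wχ volume := cχ.aestronglyMeasurable
  have mwg : AEStronglyMeasurable wg volume := cwg.aestronglyMeasurable
  have bwΔ : ∀ᵐ z ∂(volume : Measure (ℝ × E)), ‖wΔ z‖ ≤ CΔ := Eventually.of_forall hCΔ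
  have bwχ : ∀ᵐ z ∂(volume : Measure (ℝ × E)), ‖wχ z‖ ≤ Cχ := Eventually.of_forall hCχ
  have bwg : ∀ᵐ z ∂(volume : Measure (ℝ × E)), ‖wg z‖ ≤ Cg := Eventually.of_forall hCg
  -- the bilinear forms
  set βI : E →L[ℝ] E →L[ℝ] ℝ := innerSL ℝ with hβI
  set βs : ℝ →L[ℝ] E →L[ℝ] E := ContinuousLinearMap.lsmul ℝ ℝ with hβs
  have βI_apply : ∀ x y : E, βI x y = ⟪x, y⟫ := fun x y => rfl
  have βs_apply : ∀ (c : ℝ) (x : E), βs c x = c • x := fun c x => rfl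
  have wg_apply : ∀ (z : ℝ × E) (x : E), wg z x = ⟪gradient (χ z.1) z.2, x⟫ := fun z x => rfl
  -- ## (4) the dissipation bound for pairs of indices
  set d : ℕ := Fintype.card (Fin (finrank ℝ E)) with hd
  set ε : ℝ := ν / ((d : ℝ) + 1) with hε
  have hεpos : 0 < ε := by rw [hε]; positivity
  have hεν : (d : ℝ) * ε ≤ ν := by
    rw [hε, mul_div_assoc', div_le_iff₀ (by positivity)]
    nlinarith [hν]
  -- the difference fields along `ℕ × ℕ`
  set A : ℕ × ℕ → ℝ × E → E := fun mn => uncurry (V mn.1) - uncurry (V mn.2) with hA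
  set Nd : Fin (finrank ℝ E) → ℕ × ℕ → ℝ × E → E := fun i mn =>
    uncurry (N mn.1 i) - uncurry (N mn.2 i) with hNd
  set Pd : ℕ × ℕ → ℝ × E → ℝ := fun mn => uncurry (Pm mn.1) - uncurry (Pm mn.2) with hPd
  set X : ℕ × ℕ → ℝ := fun mn => ∫ z in S, χ z.1 z.2 * frobeniusNormSq (D mn.1 z - D mn.2 z)
    with hX
  set T1 : ℕ × ℕ → ℝ := fun mn => ∫ z in S, wΔ z * βI (A mn z) (A mn z) with hT1
  set T2a : Fin (finrank ℝ E) → ℕ × ℕ → ℝ := fun i mn =>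
    ∫ z in S, wg z (innerSmulBilin (b i) (A mn z) (Nd i mn z)) with hT2a
  set T3 : ℕ × ℕ → ℝ := fun mn => ∫ z in S, wg z (βs (Pd mn z) (A mn z)) with hT3
  set Y : Fin (finrank ℝ E) → ℕ × ℕ → ℝ := fun i mn =>
    ∫ z in S, wχ z * βI (Nd i mn z) (Nd i mn z) with hY
  have hpair : ∀ mn : ℕ × ℕ, (bump mn.1).rOut ≤ δ → (bump mn.2).rOut ≤ δ →
      ν * X mn ≤ T1 mn + 2 * (∑ i, T2a i mn) + 2 * T3 mn + ε⁻¹ * (∑ i, Y i mn) := by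
    rintro ⟨m, n⟩ hm hn
    -- the difference kernel
    have hk' : ContDiff ℝ (⊤ : ℕ∞) (k m - k n) := (hkinf m).sub (hkinf n)
    have hkr' : ∀ w, w ∉ closedBall (0 : ℝ × E) δ → (k m - k n) w = 0 := fun w hw => by
      have hwm : w ∉ closedBall (0 : ℝ × E) (bump m).rOut := fun h =>
        hw (closedBall_subset_closedBall hm h)
      have hwn : w ∉ closedBall (0 : ℝ × E) (bump n).rOut := fun h =>
        hw (closedBall_subset_closedBall hn h)
      simp only [Pi.sub_apply, hkr m w hwm, hkr n w hwn, sub_zero]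
    have h := mollified_dissipation_le b hNS huI hu2I hpI hk' hkr' hχ hχ0
      (fun z hz => hball z hz δ le_rfl) hat hχa hχt hεpos hεν
    -- rewriting the difference mollifications
    have eV : stMollify (k m - k n) ũ = fun s y => V m s y - V n s y :=
      stMollify_sub_kernel (hkinf m).continuous (hkc m) (hkinf n).continuous (hkc n) hũi
    have eP : stMollify (k m - k n) pt = fun s y => Pm m s y - Pm n s y :=
      stMollify_sub_kernel (hkinf m).continuous (hkc m) (hkinf n).continuous (hkc n) hpti
    have eN : ∀ i, stMollify (k m - k n) (Nt i) = fun s y => N m i s y - N n i s y := fun i =>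
      stMollify_sub_kernel (hkinf m).continuous (hkc m) (hkinf n).continuous (hkc n) (hNtli i)
    have eD : ∀ z : ℝ × E, fderiv ℝ (fun y => V m z.1 y - V n z.1 y) z.2 = D m z - D n z :=
      fun z => fderiv_sub (hDdiff m z) (hDdiff n z)
    have eNt : ∀ i, (zeroExt Ω fun s y => ⟪u s y, b i⟫ • u s y) = Nt i := fun i => rfl
    simp only [eNt] at h
    rw [eV, eP] at h
    simp only [eN, eD] at h
    -- identification, term by term
    have e1 : (∫ z in S, ‖V m z.1 z.2 - V n z.1 z.2‖ ^ 2 *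
        (ν * (Δ (χ z.1)) z.2 + timeDeriv χ z.1 z.2)) = T1 (m, n) := by
      refine setIntegral_congr_fun hSm fun z _ => ?_
      simp only [hA, hwΔ, βI_apply, real_inner_self_eq_norm_sq, Pi.sub_apply, uncurry,
        mul_comm]
    have e2 : (∑ i, ∫ z in S, ⟪N m i z.1 z.2 - N n i z.1 z.2, gradient (χ z.1) z.2⟫ *
        ⟪V m z.1 z.2 - V n z.1 z.2, b i⟫) = ∑ i, T2a i (m, n) := by
      refine Finset.sum_congr rfl fun i _ => ?_
      refine setIntegral_congr_fun hSm fun z _ => ?_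
      simp only [hA, hNd, wg_apply, innerSmulBilin_apply, real_inner_smul_right, Pi.sub_apply,
        uncurry]
      rw [real_inner_comm (gradient (χ z.1) z.2)]
      ring
    have e3 : (∫ z in S, (Pm m z.1 z.2 - Pm n z.1 z.2) * ⟪V m z.1 z.2 - V n z.1 z.2,
        gradient (χ z.1) z.2⟫) = T3 (m, n) := by
      refine setIntegral_congr_fun hSm fun z _ => ?_
      simp only [hA, hPd, wg_apply, βs_apply, real_inner_smul_right, Pi.sub_apply, uncurry]
      rw [real_inner_comm (gradient (χ z.1) z.2)]
    have e4 : (∑ i, ∫ z in S, χ z.1 z.2 * ‖N m i z.1 z.2 - N n i z.1 z.2‖ ^ 2) =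
        ∑ i, Y i (m, n) := by
      refine Finset.sum_congr rfl fun i _ => ?_
      refine setIntegral_congr_fun hSm fun z _ => ?_
      simp only [hNd, hwχ, βI_apply, real_inner_self_eq_norm_sq, Pi.sub_apply, uncurry]
    have e0 : (∫ z in S, χ z.1 z.2 * frobeniusNormSq (D m z - D n z)) = X (m, n) := rfl
    rw [e0, e1, e2, e3, e4] at h
    exact h
  -- ## (5) the right-hand sides tend to zero along `atTop` on `ℕ × ℕ`
  have hfst := tendsto_fst_atTop_prod
  have hsnd := tendsto_snd_atTop_prod
  have mA2 : ∀ mn, MemLp (A mn) 2 volume := fun mn => (mV2 mn.1).sub (mV2 mn.2)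
  have mA3 : ∀ mn, MemLp (A mn) 3 volume := fun mn => (mV3 mn.1).sub (mV3 mn.2)
  have mNd : ∀ i mn, MemLp (Nd i mn) 2 volume := fun i mn => (mN mn.1 i).sub (mN mn.2 i)
  have mPd : ∀ mn, MemLp (Pd mn) (3 / 2) volume := fun mn => (mP mn.1).sub (mP mn.2)
  have m0E2 : MemLp (0 : ℝ × E → E) 2 (volume : Measure (ℝ × E)) := MemLp.zero
  have m0E3 : MemLp (0 : ℝ × E → E) 3 (volume : Measure (ℝ × E)) := MemLp.zero
  have m0R : MemLp (0 : ℝ × E → ℝ) (3 / 2) (volume : Measure (ℝ × E)) := MemLp.zero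
  have cA2 : Tendsto (fun mn => eLpNorm (A mn - 0) 2 volume) atTop (𝓝 0) :=
    tendsto_eLpNorm_sub_sub_of_tendsto (A := fun n => uncurry (V n)) one_le_two
      (fun n => (mV2 n).1) hũ2.1 cV2 hfst hsnd
  have cA3 : Tendsto (fun mn => eLpNorm (A mn - 0) 3 volume) atTop (𝓝 0) :=
    tendsto_eLpNorm_sub_sub_of_tendsto (A := fun n => uncurry (V n)) (by norm_num)
      (fun n => (mV3 n).1) hũ3.1 cV3 hfst hsnd
  have cNd : ∀ i, Tendsto (fun mn => eLpNorm (Nd i mn - 0) 2 volume) atTop (𝓝 0) := fun i =>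
    tendsto_eLpNorm_sub_sub_of_tendsto (A := fun n => uncurry (N n i)) one_le_two
      (fun n => (mN n i).1) (hNt2 i).1 (cN i) hfst hsnd
  have cPd : Tendsto (fun mn => eLpNorm (Pd mn - 0) (3 / 2) volume) atTop (𝓝 0) :=
    tendsto_eLpNorm_sub_sub_of_tendsto (A := fun n => uncurry (Pm n)) one_le_three_halves
      (fun n => (mP n).1) hpt32.1 cP hfst hsnd
  have limT1 : Tendsto T1 atTop (𝓝 0) := by
    have h := tendsto_setIntegral_mul_bilin' (l := (atTop : Filter (ℕ × ℕ))) (p := 2) (q := 2)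
      one_le_two βI mA2 m0E2 mA2 m0E2 cA2 cA2 mwΔ bwΔ S
    simpa using h
  have limT2a : ∀ i, Tendsto (T2a i) atTop (𝓝 0) := fun i => by
    have h := tendsto_setIntegral_clm_bilin' (l := (atTop : Filter (ℕ × ℕ))) (p := 2) (q := 2)
      one_le_two (innerSmulBilin (b i)) mA2 m0E2 (mNd i) m0E2 cA2 (cNd i) mwg bwg S
    have e : (∫ z in S, wg z (innerSmulBilin (b i) ((0 : ℝ × E → E) z) ((0 : ℝ × E → E) z))) = 0 := by
      simp
    rw [e] at h
    exact h
  have limT3 : Tendsto T3 atTop (𝓝 0) := by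
    have h := tendsto_setIntegral_clm_bilin' (l := (atTop : Filter (ℕ × ℕ))) (p := 3 / 2)
      (q := 3) (by norm_num) βs mPd m0R mA3 m0E3 cPd cA3 mwg bwg S
    simpa using h
  have limY : ∀ i, Tendsto (Y i) atTop (𝓝 0) := fun i => by
    have h := tendsto_setIntegral_mul_bilin' (l := (atTop : Filter (ℕ × ℕ))) (p := 2) (q := 2)
      one_le_two βI (mNd i) m0E2 (mNd i) m0E2 (cNd i) (cNd i) mwχ bwχ S
    simpa using h
  have limB : Tendsto (fun mn => T1 mn + 2 * (∑ i, T2a i mn) + 2 * T3 mn + ε⁻¹ * (∑ i, Y i mn))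
      atTop (𝓝 0) := by
    have h := ((limT1.add ((tendsto_finsetSum (Finset.univ : Finset (Fin (finrank ℝ E)))
      fun i _ => limT2a i).const_mul 2)).add (limT3.const_mul 2)).add
      ((tendsto_finsetSum (Finset.univ : Finset (Fin (finrank ℝ E))) fun i _ => limY i).const_mul
        ε⁻¹)
    simpa using h
  -- ## (6) hence `X → 0` and the `L²` distances of the truncated gradients tend to zero
  have hev : ∀ᶠ mn : ℕ × ℕ in atTop, (bump mn.1).rOut ≤ δ ∧ (bump mn.2).rOut ≤ δ := by
    have h1 : ∀ᶠ n in atTop, (bump n).rOut ≤ δ :=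
      ((tendsto_order.1 hbr).2 δ hδ).mono fun n hn => hn.le
    exact (hfst.eventually h1).and (hsnd.eventually h1)
  have hX0 : ∀ mn, 0 ≤ X mn := fun mn =>
    setIntegral_nonneg hSm fun z _ => mul_nonneg (hχ0 z.1 z.2) (frobeniusNormSq_nonneg _)
  have limX : Tendsto X atTop (𝓝 0) := by
    have hup : Tendsto (fun mn => ν⁻¹ * (T1 mn + 2 * (∑ i, T2a i mn) + 2 * T3 mn +
        ε⁻¹ * (∑ i, Y i mn))) atTop (𝓝 0) := by
      simpa using limB.const_mul ν⁻¹
    refine tendsto_of_tendsto_of_tendsto_of_le_of_le' tendsto_const_nhds hup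
      (Eventually.of_forall hX0) (hev.mono fun mn hmn => ?_)
    have h := hpair mn hmn.1 hmn.2
    rw [← div_eq_inv_mul, le_div_iff₀' hν]
    exact h
  -- the truncated gradients
  set F : ℕ → ℝ × E → E →L[ℝ] E := fun n => K.indicator (D n) with hF
  have hF2 : ∀ n, MemLp (F n) 2 volume := fun n => memLp_indicator_of_continuous (hDc n) hK 2
  -- the integrand `χ |D m - D n|²` on the whole space
  have hfrob_int : ∀ m n, Integrable (fun z : ℝ × E => χ z.1 z.2 *
      frobeniusNormSq (D m z - D n z)) volume := fun m n => by
    refine Continuous.integrable_of_hasCompactSupport ?_ ?_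
    · exact cχ.mul (LerayHopfProofs.continuous_frobeniusNormSq.comp ((hDc m).sub (hDc n)))
    · exact HasCompactSupport.intro hsuppχ fun z hz => by
        rw [show χ z.1 z.2 = wχ z from rfl, (hw0 z hz).1, zero_mul]
  have hdist : ∀ mn : ℕ × ℕ, eLpNorm (F mn.1 - F mn.2) 2 volume ≤
      ENNReal.ofReal (X mn) ^ (1 / 2 : ℝ) := by
    rintro ⟨m, n⟩
    rw [eLpNorm_two_eq_rpow]
    gcongr
    calc ∫⁻ z, ‖(F m - F n) z‖ₑ ^ 2
        ≤ ∫⁻ z, ENNReal.ofReal (χ z.1 z.2 * frobeniusNormSq (D m z - D n z)) :=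
          lintegral_mono fun z => enorm_indicator_sub_sq_le (w := fun z : ℝ × E => χ z.1 z.2)
            hχ1 z
      _ = ENNReal.ofReal (∫ z, χ z.1 z.2 * frobeniusNormSq (D m z - D n z)) := by
          rw [ofReal_integral_eq_lintegral_ofReal (hfrob_int m n)
            (Eventually.of_forall fun z => mul_nonneg (hχ0 z.1 z.2) (frobeniusNormSq_nonneg _))]
      _ = ENNReal.ofReal (X (m, n)) := by
          rw [hX]
          dsimp only
          rw [setIntegral_eq_integral_of_forall_compl_eq_zero fun z hz => by
            rw [hχS z hz, zero_mul]]
  have limdist : Tendsto (fun mn : ℕ × ℕ => eLpNorm (F mn.1 - F mn.2) 2 volume) atTop (𝓝 0) := by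
    have hup : Tendsto (fun mn => ENNReal.ofReal (X mn) ^ (1 / 2 : ℝ)) atTop (𝓝 0) := by
      have h := ((ENNReal.tendsto_ofReal limX).ennrpow_const (1 / 2 : ℝ))
      rwa [ENNReal.ofReal_zero, ENNReal.zero_rpow_of_pos (by norm_num)] at h
    exact tendsto_of_tendsto_of_tendsto_of_le_of_le tendsto_const_nhds hup (fun mn => zero_le)
      hdist
  -- ## (7) Cauchy in `L²`, hence convergent
  set f : ℕ → Lp (E →L[ℝ] E) 2 (volume : Measure (ℝ × E)) := fun n => (hF2 n).toLp (F n) with hf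
  have hcau : CauchySeq f := by
    rw [Lp.cauchySeq_Lp_iff_cauchySeq_eLpNorm]
    refine (tendsto_congr fun mn => ?_).2 limdist
    exact eLpNorm_congr_ae (((hF2 mn.1).coeFn_toLp).sub ((hF2 mn.2).coeFn_toLp))
  obtain ⟨L, hL⟩ := cauchySeq_tendsto_of_complete hcau
  refine ⟨L, Lp.memLp L, ?_⟩
  have h1 := (Lp.tendsto_Lp_iff_tendsto_eLpNorm' f L).1 hL
  refine (tendsto_congr fun n => ?_).1 h1
  exact eLpNorm_congr_ae (((hF2 n).coeFn_toLp).sub EventuallyEq.rfl)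

end Cauchy

end Literature.Analysis.FluidPDE
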